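import Summits.ResolutionOfSingularities.ResolutionOfSingularities.Theorems.WeightedInvariantQuasiRegularWeightedMonomials
import HarnessLib

/-!
# Weighted monomial ideals in a quasi-regular sequence are primary — part 2: the colon property

Route `ResolutionOfSingularities/WeightedInvariant`, door crux `HypersurfaceCentreConstruction`
(stmt-ResolutionOfSingularities-19897) — OURS, helper; continuation of
`Theorems/WeightedInvariantQuasiRegularWeightedMonomials.lean` (e-ladder plan of `res-L1-w43-stub-10`, lemma L3:
«a weighted-chart piece is `(u)`-primary, hence determined by its germ at the generic point of `V(u)`»).

For a quasi-regular family `u : ι → R` (`IsQuasiRegular`), `I = (u)`, positive weights `w`,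
`𝒥ₙ = Ideal.span (weightedMonomials u w n)`:

* `coeff_mem_span_of_eval_mem` — KEY STEP: a degree-`s` form all of whose monomials have weight `< n` and
  which evaluates into `𝒥ₙ` has all its coefficients in `I` (quasi-regularity against the normal form
  `exists_form_of_mem_span_weightedMonomials`);
* `mem_span_weightedMonomials_of_mul_mem` — **`(𝒥ₙ : a) = 𝒥ₙ` whenever `(I : a) = I`** (the weighted analogue
  of Matsumura's Thm. 16.2 (ii) `IsQuasiRegular.mem_pow_of_mul_mem_pow`, the case of all weights `1`):
  induction `b ∈ 𝒥ₙ + Iˢ`, splitting the degree-`s` form of the `Iˢ`-part by weight;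
* `isPrimary_span_weightedMonomials` — if `I` is prime, every `𝒥ₙ` (`n ≥ 1`) is `I`-primary.

Pure commutative algebra; no named facts. [cite: Matsumura1987, Thm. 16.2; Wlodarczyk2022, Lemma 2.1.9]
-/

noncomputable section

set_option linter.dupNamespace false -- mandated namespace of this single-conjunct summit

namespace Summit.ResolutionOfSingularities.ResolutionOfSingularities.Theorems

universe u v

open MvPolynomial Literature.AlgebraicGeometry.Resolution

variable {R : Type u} [CommRing R] {ι : Type v} (u : ι → R) (w : ι → ℕ)

section QuasiRegular

variable [Fintype ι]

/-- **Key step.** If `u` is quasi-regular and `G` is a form of degree `s` all of whose monomials have weight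
`< n`, then `G(u) ∈ 𝒥ₙ` forces every coefficient of `G` into `I = (u)`: by
`exists_form_of_mem_span_weightedMonomials`, `G(u) ≡ Pₛ(u) (mod I^{s+1})` for a degree-`s` form `Pₛ` with
monomials of weight `≥ n`, so quasi-regularity puts the coefficients of `G − Pₛ` in `I`, and `G`, `Pₛ` have
disjoint supports. [folklore] -/
theorem coeff_mem_span_of_eval_mem (hu : IsQuasiRegular u) {n s : ℕ} {G : MvPolynomial ι R}
    (hG : G.IsHomogeneous s) (hGn : ∀ α ∈ G.support, Finsupp.weight w α < n)
    (hGe : eval u G ∈ Ideal.span (weightedMonomials u w n)) (α : ι →₀ ℕ) :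
    G.coeff α ∈ Ideal.span (Set.range u) := by
  obtain ⟨P, hP, hPy, hP0⟩ :=
    exists_form_of_mem_span_weightedMonomials u w hu hGe (eval_mem_span_pow u hG) s le_rfl
  set Ps := homogeneousComponent s P with hPs_def
  have hPs : Ps.IsHomogeneous s := homogeneousComponent_isHomogeneous s P
  have hPsn : Ps ∈ Ideal.span ((fun α => monomial α (1 : R)) '' {α | n ≤ Finsupp.weight w α}) :=
    homogeneousComponent_mem_span_monomial_weight w hP s
  -- `G(u) - Pₛ(u) ∈ I^{s+1}`
  have hsum : ∑ i ∈ Finset.range (P.totalDegree + 1), eval u (homogeneousComponent i P) = eval u G := by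
    rw [← map_sum, sum_homogeneousComponent, hPy]
  have hothers : ∀ i ∈ Finset.range (P.totalDegree + 1), i ≠ s →
      eval u (homogeneousComponent i P) ∈ Ideal.span (Set.range u) ^ (s + 1) := by
    intro i _ his
    rcases lt_or_gt_of_ne his with hlt | hgt
    · rw [hP0 i hlt, map_zero]
      exact Ideal.zero_mem _
    · exact Ideal.pow_le_pow_right hgt (eval_mem_span_pow u (homogeneousComponent_isHomogeneous i P))
  have hdiff : eval u (G - Ps) ∈ Ideal.span (Set.range u) ^ (s + 1) := by
    rw [map_sub]
    by_cases hs : s ∈ Finset.range (P.totalDegree + 1)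
    · have hsplit := Finset.add_sum_erase (Finset.range (P.totalDegree + 1))
        (fun i => eval u (homogeneousComponent i P)) hs
      rw [hsum] at hsplit
      have hrest : ∑ i ∈ (Finset.range (P.totalDegree + 1)).erase s,
          eval u (homogeneousComponent i P) ∈ Ideal.span (Set.range u) ^ (s + 1) :=
        Ideal.sum_mem _ fun i hi =>
          hothers i (Finset.mem_of_mem_erase hi) (Finset.ne_of_mem_erase hi)
      have : eval u G - eval u Ps = ∑ i ∈ (Finset.range (P.totalDegree + 1)).erase s,
          eval u (homogeneousComponent i P) := by
        rw [hPs_def, ← hsplit, add_sub_cancel_left]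
      rw [this]
      exact hrest
    · rw [Finset.mem_range, not_lt] at hs
      rw [hPs_def, homogeneousComponent_eq_zero _ _ (Nat.lt_of_succ_le hs), map_zero, sub_zero]
      -- all components of `P` of degree `< s` vanish and `P` has total degree `< s`: `P = 0`
      have hP00 : P = 0 := by
        rw [← sum_homogeneousComponent P]
        exact Finset.sum_eq_zero fun i hi =>
          hP0 i (lt_of_lt_of_le (Finset.mem_range.mp hi) hs)
      rw [← hPy, hP00, map_zero]
      exact Ideal.zero_mem _
  -- quasi-regularity: coefficients of `G - Pₛ` lie in `I`
  have hq : (G - Ps).coeff α ∈ Ideal.span (Set.range u) :=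
    (isQuasiRegular_def u).mp hu s (G - Ps) (hG.sub hPs) hdiff α
  -- disjoint supports
  by_cases hα : α ∈ G.support
  · have hαPs : Ps.coeff α = 0 := by
      rw [mem_span_monomial_weight_iff] at hPsn
      by_contra h
      exact absurd (hPsn α (mem_support_iff.mpr h)) (not_le.mpr (hGn α hα))
    rwa [coeff_sub, hαPs, sub_zero] at hq
  · rw [notMem_support_iff.mp hα]
    exact Ideal.zero_mem _

/-! ## The colon property and primaryness -/

/-- **`(𝒥ₙ : a) = 𝒥ₙ` whenever `(I : a) = I`** (weighted Matsumura 16.2 (ii)): for a quasi-regular family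
`u` with positive weights `w`, if `a` is a non-zero-divisor modulo `I = (u)` and `a · b ∈ 𝒥ₙ`, then `b ∈ 𝒥ₙ`.
Proof: show `b ∈ 𝒥ₙ + Iˢ` for every `s` and use `Iⁿ ⊆ 𝒥ₙ`; in the inductive step write the `Iˢ`-part of
`b` as a degree-`s` form, split it by weight, and apply `coeff_mem_span_of_eval_mem` to `a ·` (the
low-weight part). [cite: Matsumura1987, Thm. 16.2 (ii)] -/
theorem mem_span_weightedMonomials_of_mul_mem (hu : IsQuasiRegular u) (hw : ∀ i, 0 < w i) {a : R}
    (ha : ∀ y, a * y ∈ Ideal.span (Set.range u) → y ∈ Ideal.span (Set.range u)) (n : ℕ) {b : R}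
    (hb : a * b ∈ Ideal.span (weightedMonomials u w n)) : b ∈ Ideal.span (weightedMonomials u w n) := by
  classical
  set J := Ideal.span (weightedMonomials u w n) with hJ
  suffices h : ∀ s, b ∈ J ⊔ Ideal.span (Set.range u) ^ s by
    have := h n
    rwa [sup_eq_left.mpr (span_pow_le_span_weightedMonomials u w hw le_rfl)] at this
  intro s
  induction s with
  | zero =>
    rw [pow_zero, Ideal.one_eq_top, sup_top_eq]
    exact Submodule.mem_top
  | succ s ih =>
    obtain ⟨j, hj, c, hc, hjc⟩ := Submodule.mem_sup.mp ih
    obtain ⟨F, hF, rfl⟩ := exists_isHomogeneous_of_mem_span_pow u s hc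
    -- split `F` by weight
    set Fhi := ∑ α ∈ F.support with n ≤ Finsupp.weight w α, monomial α (F.coeff α) with hFhi_def
    set Flo := ∑ α ∈ F.support with ¬ n ≤ Finsupp.weight w α, monomial α (F.coeff α) with hFlo_def
    have hsplit : F = Fhi + Flo := by
      rw [hFhi_def, hFlo_def, Finset.sum_filter_add_sum_filter_not]
      exact F.as_sum
    have hFhi : eval u Fhi ∈ J := by
      refine eval_mem_span_weightedMonomials u w (Ideal.sum_mem _ fun α hα => ?_)
      rw [Finset.mem_filter] at hα
      have : monomial α (F.coeff α) = C (F.coeff α) * monomial α 1 := by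
        rw [C_mul_monomial, mul_one]
      rw [this]
      exact Ideal.mul_mem_left _ _ (Ideal.subset_span ⟨α, hα.2, rfl⟩)
    have hFlo_hom : Flo.IsHomogeneous s := by
      rw [← mem_homogeneousSubmodule, hFlo_def]
      refine Submodule.sum_mem _ fun α hα => ?_
      rw [Finset.mem_filter] at hα
      rw [mem_homogeneousSubmodule]
      refine isHomogeneous_monomial _ ?_
      rw [Finsupp.degree_eq_weight_one]
      exact hF (mem_support_iff.mp hα.1)
    have hFlo_coeff : ∀ β, Flo.coeff β =
        if β ∈ F.support.filter (fun α => ¬ n ≤ Finsupp.weight w α) then F.coeff β else 0 := by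
      intro β
      rw [hFlo_def, coeff_sum]
      simp_rw [coeff_monomial]
      rw [Finset.sum_ite_eq']
    have hFlo_supp : ∀ β ∈ Flo.support, Finsupp.weight w β < n := by
      intro β hβ
      rw [mem_support_iff, hFlo_coeff] at hβ
      split_ifs at hβ with h
      · exact not_le.mp (Finset.mem_filter.mp h).2
      · exact absurd rfl hβ
    -- `a · Flo(u) ∈ J`
    have haFlo : a * eval u Flo ∈ J := by
      have h1 : a * eval u Flo = a * b - a * (j + eval u Fhi) := by
        rw [← hjc, hsplit, map_add]; ring
      rw [h1]
      exact Ideal.sub_mem _ hb (Ideal.mul_mem_left _ _ (Ideal.add_mem _ hj hFhi))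
    -- hence all coefficients of `a • Flo` lie in `I`, hence those of `Flo`
    have hG : ∀ β, (C a * Flo).coeff β ∈ Ideal.span (Set.range u) := by
      refine coeff_mem_span_of_eval_mem u w hu (n := n) (hFlo_hom.C_mul a) ?_ ?_
      · intro β hβ
        refine hFlo_supp β ?_
        rw [mem_support_iff] at hβ ⊢
        rw [coeff_C_mul] at hβ
        exact right_ne_zero_of_mul hβ
      · rwa [map_mul, eval_C]
    have hFloI : Flo ∈ Ideal.map (C : R →+* MvPolynomial ι R) (Ideal.span (Set.range u)) := by
      rw [mem_map_C_iff]
      intro β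
      exact ha _ (by simpa only [coeff_C_mul] using hG β)
    have hFlo_eval : eval u Flo ∈ Ideal.span (Set.range u) ^ (s + 1) := by
      have := eval_mem_mul_span_pow u hFlo_hom hFloI
      rwa [← pow_succ'] at this
    -- conclude
    refine Submodule.mem_sup.mpr ⟨j + eval u Fhi, Ideal.add_mem _ hj hFhi, eval u Flo, hFlo_eval, ?_⟩
    rw [← hjc, hsplit, map_add, add_assoc]

/-- **Weighted-chart pieces are primary.** For a quasi-regular family `u` whose ideal `I = (u)` is PRIME
and positive weights `w`, every piece `𝒥ₙ = (u^α : Σ αᵢ wᵢ ≥ n)`, `n ≥ 1`, is an `I`-primary ideal: it has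
no embedded components, so it is determined by its extension to the local ring at `I` (Włodarczyk's
valuation ideals `I_{ν,n}` of the monomial valuation, Lemma 2.1.9, in the generality of a quasi-regular
sequence). [cite: Wlodarczyk2022, Lemma 2.1.9; Matsumura1987, Thm. 16.2] -/
theorem isPrimary_span_weightedMonomials (hu : IsQuasiRegular u) (hw : ∀ i, 0 < w i) {n : ℕ}
    (hn : 1 ≤ n) (hI : (Ideal.span (Set.range u)).IsPrime) :
    (Ideal.span (weightedMonomials u w n)).IsPrimary := by
  rw [Ideal.isPrimary_iff]
  refine ⟨fun htop => hI.ne_top (top_le_iff.mp (htop ▸ span_weightedMonomials_le_span u w hn)), ?_⟩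
  intro x y hxy
  by_cases hy : y ∈ (Ideal.span (weightedMonomials u w n)).radical
  · exact Or.inr hy
  · left
    rw [radical_span_weightedMonomials u w hw hn hI.isRadical] at hy
    refine mem_span_weightedMonomials_of_mul_mem u w hu hw (a := y) ?_ n (by rwa [mul_comm] at hxy)
    intro z hz
    exact (hI.mem_or_mem hz).resolve_left hy

end QuasiRegular

end Summit.ResolutionOfSingularities.ResolutionOfSingularities.Theorems

end
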